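import Summits.AtomisticToContinuum.HydrodynamicLimit.Theorems.JParityClosureLocalSecondLawLedgerKernel
import Summits.AtomisticToContinuum.HydrodynamicLimit.Theorems.LocalSecondLaw.Negative.EquilibriumL1
import Literature.MathematicalPhysics.KineticTheory.HardSphereUniformGas

/-!
# Cold balls, part B: the coarse temperature as a weighted velocity variance

Lead c2's stub `eq_coldBalls` of the equilibrium side-composition of line `exact-entropy-ledger-three-passivities` for the
crux `JParityClosure.LocalSecondLaw` (stmt-AtomisticToContinuum-13081).  Deterministic facts about the cone fields of ONE
configuration at one field point `x₀`, with weights `bᵢ = b_r(xᵢ, x₀) ≥ 0`: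

* `three_thetaC_mul_rhoC_sq` — the Lagrange identity `3 θ_r ρ_r² = (N+1)⁻² · ½ ∑ᵢⱼ bᵢ bⱼ ‖vᵢ − vⱼ‖²`;
* `coldBalls_pairBound` (registered sub-goal) — hence for every pair `i ≠ j`: `(N+1)⁻² bᵢ bⱼ ‖vᵢ − vⱼ‖² ≤ 3 θ_r ρ_r²` (a two-particle lower bound
  of the temperature; the lead's replacement for floors);
* `thetaC_nonneg'`, `thetaC_eq_zero_of_subsingleton_support` — `θ_r ≥ 0`, and `θ_r = 0` when at most one particle is in
  the ball;
* `thetaC_shift_decomposition` — `3θ_r = 3Θ + 2∑pᵢYᵢ − 2⟪ū, m̃⟫ − ‖m̃‖²` with `pᵢ = bᵢ/∑b`, `Yᵢ` the centred kinetic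
  energy and `m̃ = ∑pᵢ(vᵢ − ū)` (the form in which Chebyshev applies);
* `coldEvent_subset` — `{θ_r < Θ/2} ⊆ {Θ/4 ≤ |∑pᵢYᵢ|} ∪ {λ₀ < ‖m̃‖}`.
-/

noncomputable section

namespace Summit.AtomisticToContinuum.HydrodynamicLimit.Theorems.LocalSecondLawEquilibrium

open scoped BigOperators Topology Classical MeasureTheory ENNReal InnerProductSpace
open Filter Set MeasureTheory
open Literature.MathematicalPhysics.KineticTheory
open Literature.Analysis.FluidPDE
open Summit.AtomisticToContinuum.HydrodynamicLimit.Theorems.LocalSecondLawNegative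
open Summit.AtomisticToContinuum.HydrodynamicLimit.Theorems.LocalSecondLawLedger
open Summit.AtomisticToContinuum.HydrodynamicLimit.Theorems.LocalSecondLawLedger.L

variable {N : ℕ}

/-! ## The Lagrange identity -/

/-- `‖∑ᵢ cᵢ • vᵢ‖² = ∑ᵢ∑ⱼ cᵢ cⱼ ⟪vᵢ, vⱼ⟫`. -/
theorem norm_sum_smul_sq (c : Fin (N + 1) → ℝ) (v : Fin (N + 1) → V3) :
    ‖∑ i, c i • v i‖ ^ 2 = ∑ i, ∑ j, c i * c j * ⟪v i, v j⟫_ℝ := by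
  rw [← real_inner_self_eq_norm_sq, sum_inner]
  refine Finset.sum_congr rfl fun i _ => ?_
  rw [inner_sum]
  refine Finset.sum_congr rfl fun j _ => ?_
  rw [real_inner_smul_left, real_inner_smul_right]; ring

/-- The symmetrised Lagrange identity for nonnegative... (any real) weights:
`(∑ᵢ cᵢ‖vᵢ‖²)(∑ⱼ cⱼ) − ‖∑ᵢ cᵢvᵢ‖² = ½ ∑ᵢ∑ⱼ cᵢcⱼ‖vᵢ − vⱼ‖²`. -/
theorem lagrange_identity (c : Fin (N + 1) → ℝ) (v : Fin (N + 1) → V3) :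
    (∑ i, c i * ‖v i‖ ^ 2) * (∑ j, c j) - ‖∑ i, c i • v i‖ ^ 2 =
      1 / 2 * ∑ i, ∑ j, c i * c j * ‖v i - v j‖ ^ 2 := by
  rw [norm_sum_smul_sq, Finset.sum_mul_sum]
  have e1 : ∑ i, ∑ j, c i * c j * ‖v i - v j‖ ^ 2 =
      ∑ i, ∑ j, (c i * c j * ‖v i‖ ^ 2 + c i * c j * ‖v j‖ ^ 2 - 2 * (c i * c j * ⟪v i, v j⟫_ℝ)) :=
    Finset.sum_congr rfl fun i _ => Finset.sum_congr rfl fun j _ => by rw [norm_sub_sq_real]; ring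
  have e2 : ∑ i, ∑ j, c i * c j * ‖v j‖ ^ 2 = ∑ i, ∑ j, c i * c j * ‖v i‖ ^ 2 := by
    rw [Finset.sum_comm]
    exact Finset.sum_congr rfl fun i _ => Finset.sum_congr rfl fun j _ => by ring
  have e3 : ∑ i, ∑ j, c i * ‖v i‖ ^ 2 * c j = ∑ i, ∑ j, c i * c j * ‖v i‖ ^ 2 :=
    Finset.sum_congr rfl fun i _ => Finset.sum_congr rfl fun j _ => by ring
  rw [e1, e3]
  simp only [Finset.sum_sub_distrib, Finset.sum_add_distrib, ← Finset.mul_sum]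
  rw [e2]
  ring

/-- **The coarse temperature is a weighted velocity variance** (Lagrange form): at a field point where `ρ_r ≠ 0`,
`3 θ_r ρ_r² = (N+1)⁻² · ½ ∑ᵢ∑ⱼ bᵢ bⱼ ‖vᵢ − vⱼ‖²` with `bᵢ = b_r(xᵢ, x₀)`. -/
theorem three_thetaC_mul_rhoC_sq (r : ℝ) (w : Phase N) (x : T3) (hρ : rhoC r w x ≠ 0) :
    3 * thetaC r w x * rhoC r w x ^ 2 = ((N + 1 : ℕ) : ℝ)⁻¹ ^ 2 *
      (1 / 2 * ∑ i, ∑ j, cone r (w i).1 x * cone r (w j).1 x * ‖(w i).2 - (w j).2‖ ^ 2) := by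
  have hkey : 3 * thetaC r w x * rhoC r w x ^ 2 = 2 * kinC r w x * rhoC r w x - ‖momC r w x‖ ^ 2 := by
    unfold thetaC; field_simp; try ring
  rw [hkey, kinC_eq_sum, rhoC_eq_sum, momC_eq_sum, norm_smul, mul_pow, Real.norm_eq_abs,
    abs_of_nonneg (by positivity : (0 : ℝ) ≤ ((N + 1 : ℕ) : ℝ)⁻¹), ← lagrange_identity]
  have h3 : ∑ i, cone r (w i).1 x * (‖(w i).2‖ ^ 2 / 2) = (∑ i, cone r (w i).1 x * ‖(w i).2‖ ^ 2) / 2 := by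
    rw [Finset.sum_div]; exact Finset.sum_congr rfl fun i _ => by ring
  rw [h3]
  try ring

/-- **Two-particle lower bound of the coarse temperature** (registered sub-goal `coldBalls_pairBound` of stub
`eq_coldBalls`): for every pair `i ≠ j`, `(N+1)⁻² bᵢ bⱼ ‖vᵢ − vⱼ‖² ≤ 3 θ_r ρ_r²` (all terms of the Lagrange sum are
non-negative; the pair occurs twice). -/
theorem coldBalls_pairBound :
    ∀ {N : ℕ} {r : ℝ}, 0 < r → ∀ (w : Phase N) (x : T3), rhoC r w x ≠ 0 → ∀ {i j : Fin (N + 1)}, i ≠ j → ((N + 1 : ℕ) : ℝ)⁻¹ ^ 2 * (cone r (w i).1 x * cone r (w j).1 x * ‖(w i).2 - (w j).2‖ ^ 2) ≤ 3 * thetaC r w x * rhoC r w x ^ 2 := by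
  intro N r hr w x hρ i j hij
  rw [three_thetaC_mul_rhoC_sq r w x hρ]
  refine mul_le_mul_of_nonneg_left ?_ (by positivity)
  set T : Fin (N + 1) → Fin (N + 1) → ℝ := fun i j => cone r (w i).1 x * cone r (w j).1 x * ‖(w i).2 - (w j).2‖ ^ 2
  have hT0 : ∀ i j, 0 ≤ T i j := fun i j =>
    mul_nonneg (mul_nonneg (cone_nonneg hr _ _) (cone_nonneg hr _ _)) (sq_nonneg _)
  have hsymm : T j i = T i j := by simp only [T, norm_sub_rev]; ring
  -- the pair `(i,j)` and `(j,i)` both occur in the double sum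
  have h1 : T i j + T j i ≤ ∑ k, ∑ l, T k l := by
    have hi : T i j + T j i ≤ ∑ l, T i l + ∑ l, T j l := by
      refine add_le_add ?_ ?_
      · exact Finset.single_le_sum (f := fun l => T i l) (fun l _ => hT0 i l) (Finset.mem_univ j)
      · exact Finset.single_le_sum (f := fun l => T j l) (fun l _ => hT0 j l) (Finset.mem_univ i)
    refine hi.trans ?_
    have := Finset.add_le_sum (f := fun k => ∑ l, T k l) (fun k _ => Finset.sum_nonneg fun l _ => hT0 k l)
      (Finset.mem_univ i) (Finset.mem_univ j) hij
    exact this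
  show T i j ≤ 1 / 2 * ∑ k, ∑ l, T k l
  linarith

/-- The coarse temperature is non-negative (Lagrange form; `0` on the junk branch `ρ_r = 0`). -/
theorem thetaC_nonneg' {r : ℝ} (hr : 0 < r) (w : Phase N) (x : T3) : 0 ≤ thetaC r w x := by
  by_cases hρ : rhoC r w x = 0
  · unfold thetaC; rw [hρ]; simp
  · have hpos : 0 < rhoC r w x ^ 2 := by positivity
    have h := three_thetaC_mul_rhoC_sq r w x hρ
    have hnn : 0 ≤ ((N + 1 : ℕ) : ℝ)⁻¹ ^ 2 *
        (1 / 2 * ∑ i, ∑ j, cone r (w i).1 x * cone r (w j).1 x * ‖(w i).2 - (w j).2‖ ^ 2) := by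
      refine mul_nonneg (by positivity) (mul_nonneg (by norm_num) (Finset.sum_nonneg fun i _ =>
        Finset.sum_nonneg fun j _ => ?_))
      exact mul_nonneg (mul_nonneg (cone_nonneg hr _ _) (cone_nonneg hr _ _)) (sq_nonneg _)
    rw [← h] at hnn
    nlinarith

/-- **At most one particle in the ball forces `θ_r = 0`**: if at most one label carries a positive weight, every term of
the Lagrange sum vanishes. -/
theorem thetaC_eq_zero_of_subsingleton_support (r : ℝ) (w : Phase N) (x : T3)
    (h : ∀ i j, i ≠ j → cone r (w i).1 x = 0 ∨ cone r (w j).1 x = 0) : thetaC r w x = 0 := by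
  by_cases hρ : rhoC r w x = 0
  · unfold thetaC; rw [hρ]; simp
  · have hsum : ∑ i, ∑ j, cone r (w i).1 x * cone r (w j).1 x * ‖(w i).2 - (w j).2‖ ^ 2 = 0 := by
      refine Finset.sum_eq_zero fun i _ => Finset.sum_eq_zero fun j _ => ?_
      by_cases hij : i = j
      · subst hij; simp
      · rcases h i j hij with h0 | h0 <;> simp [h0]
    have hL := three_thetaC_mul_rhoC_sq r w x hρ
    rw [hsum, mul_zero, mul_zero] at hL
    have hpos : 0 < rhoC r w x ^ 2 := by positivity
    have : 3 * thetaC r w x = 0 := by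
      by_contra hne
      exact absurd hL (mul_ne_zero hne hpos.ne')
    linarith

/-! ## The shift decomposition (the form in which Chebyshev applies) -/

/-- With probability weights `pᵢ = bᵢ/∑b` (so `ρ_r > 0`):
`3θ_r = 3Θ + 2∑pᵢYᵢ − 2⟪ū, m̃⟫ − ‖m̃‖²`, `Yᵢ = ‖vᵢ‖²/2 − ‖ū‖²/2 − 3Θ/2`, `m̃ = ∑pᵢ(vᵢ − ū)`. -/
theorem thetaC_shift_decomposition (r : ℝ) (w : Phase N) (x : T3) (hρ : 0 < rhoC r w x)
    (Θ : ℝ) (ū : V3) :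
    let W : ℝ := ∑ i, cone r (w i).1 x
    let p : Fin (N + 1) → ℝ := fun i => cone r (w i).1 x / W
    3 * thetaC r w x = 3 * Θ + 2 * ∑ i, p i * (‖(w i).2‖ ^ 2 / 2 - ‖ū‖ ^ 2 / 2 - 3 * Θ / 2)
      - 2 * ⟪ū, ∑ i, p i • ((w i).2 - ū)⟫_ℝ - ‖∑ i, p i • ((w i).2 - ū)‖ ^ 2 := by
  intro W p
  have hN : (0 : ℝ) < ((N + 1 : ℕ) : ℝ) := by positivity
  have hW : 0 < W := by
    have h := hρ; rw [rhoC_eq_sum] at h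
    exact pos_of_mul_pos_right h (inv_nonneg.2 hN.le) |> fun h' => by simpa using (mul_pos_iff_of_pos_left (inv_pos.2 hN)).1 h
  have hp1 : ∑ i, p i = 1 := by
    simp only [p]; rw [← Finset.sum_div, div_self hW.ne']
  -- `3θ = ∑ p ‖v‖² − ‖∑ p v‖²`
  have hθ : 3 * thetaC r w x = ∑ i, p i * ‖(w i).2‖ ^ 2 - ‖∑ i, p i • (w i).2‖ ^ 2 := by
    have hρ' : rhoC r w x ≠ 0 := hρ.ne'
    have hk : kinC r w x / rhoC r w x = (∑ i, p i * ‖(w i).2‖ ^ 2) / 2 := by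
      rw [kinC_eq_sum, rhoC_eq_sum, mul_div_mul_left _ _ (inv_ne_zero hN.ne'), Finset.sum_div, Finset.sum_div]
      refine Finset.sum_congr rfl fun i _ => ?_
      simp only [p]
      field_simp
      have hWdef : (∑ i, cone r (w i).1 x) = W := rfl
      rw [hWdef, mul_div_assoc, div_self hW.ne', mul_one]
    have hm : ‖momC r w x‖ ^ 2 / (2 * rhoC r w x ^ 2) = ‖∑ i, p i • (w i).2‖ ^ 2 / 2 := by
      have hmom : momC r w x = rhoC r w x • ∑ i, p i • (w i).2 := by
        have hsum : ∑ i, p i • (w i).2 = W⁻¹ • ∑ i, cone r (w i).1 x • (w i).2 := by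
          rw [Finset.smul_sum]
          refine Finset.sum_congr rfl fun i _ => ?_
          simp only [p]
          rw [div_eq_inv_mul, mul_smul]
        rw [hsum, momC_eq_sum, rhoC_eq_sum, smul_smul]
        congr 1
        show ((N + 1 : ℕ) : ℝ)⁻¹ = ((N + 1 : ℕ) : ℝ)⁻¹ * W * W⁻¹
        field_simp
      rw [hmom, norm_smul, mul_pow, Real.norm_eq_abs, sq_abs]
      field_simp
    unfold thetaC
    rw [hk, hm]; ring
  rw [hθ]
  -- expand around `ū`
  have hmt : ∑ i, p i • (w i).2 = ū + ∑ i, p i • ((w i).2 - ū) := by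
    simp_rw [smul_sub, Finset.sum_sub_distrib, ← Finset.sum_smul, hp1, one_smul]; abel
  have hY : ∑ i, p i * ‖(w i).2‖ ^ 2 =
      (‖ū‖ ^ 2 + 3 * Θ) + 2 * ∑ i, p i * (‖(w i).2‖ ^ 2 / 2 - ‖ū‖ ^ 2 / 2 - 3 * Θ / 2) := by
    rw [Finset.mul_sum]
    have : ∀ i, 2 * (p i * (‖(w i).2‖ ^ 2 / 2 - ‖ū‖ ^ 2 / 2 - 3 * Θ / 2)) =
        p i * ‖(w i).2‖ ^ 2 - p i * (‖ū‖ ^ 2 + 3 * Θ) := fun i => by ring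
    simp_rw [this, Finset.sum_sub_distrib, ← Finset.sum_mul, hp1]; ring
  rw [hY, hmt, norm_add_sq_real]
  ring

/-- **The cold event in Chebyshev form**: with `λ₀ = min (√Θ/2) (Θ/(8(‖ū‖+1)))`,
`{θ_r < Θ/2} ⊆ {Θ/4 ≤ |∑pᵢYᵢ|} ∪ {λ₀ < ‖m̃‖}` whenever `ρ_r > 0`. -/
theorem coldEvent_subset (r : ℝ) (w : Phase N) (x : T3) (hρ : 0 < rhoC r w x)
    {Θ : ℝ} (hΘ : 0 < Θ) (ū : V3) (hcold : thetaC r w x < Θ / 2) :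
    let W : ℝ := ∑ i, cone r (w i).1 x
    let p : Fin (N + 1) → ℝ := fun i => cone r (w i).1 x / W
    Θ / 4 ≤ |∑ i, p i * (‖(w i).2‖ ^ 2 / 2 - ‖ū‖ ^ 2 / 2 - 3 * Θ / 2)| ∨
      min (Real.sqrt Θ / 2) (Θ / (8 * (‖ū‖ + 1))) < ‖∑ i, p i • ((w i).2 - ū)‖ := by
  intro W p
  by_contra hcon
  push Not at hcon
  obtain ⟨hA, hB⟩ := hcon
  set S : ℝ := ∑ i, p i * (‖(w i).2‖ ^ 2 / 2 - ‖ū‖ ^ 2 / 2 - 3 * Θ / 2) with hS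
  set m : V3 := ∑ i, p i • ((w i).2 - ū) with hm
  have hdec := thetaC_shift_decomposition r w x hρ Θ ū
  simp only at hdec
  rw [← hS, ← hm] at hdec
  have hS' : -(Θ / 4) < S := by rw [abs_lt] at hA; exact hA.1
  have hm1 : ‖m‖ ≤ Real.sqrt Θ / 2 := hB.trans (min_le_left _ _)
  have hm2 : ‖m‖ ≤ Θ / (8 * (‖ū‖ + 1)) := hB.trans (min_le_right _ _)
  have hmsq : ‖m‖ ^ 2 ≤ Θ / 4 := by
    have h0 : 0 ≤ ‖m‖ := norm_nonneg _
    have h1 : ‖m‖ ^ 2 ≤ (Real.sqrt Θ / 2) ^ 2 := pow_le_pow_left₀ h0 hm1 2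
    rw [div_pow, Real.sq_sqrt hΘ.le] at h1
    linarith
  have hinner : |⟪ū, m⟫_ℝ| ≤ Θ / 8 := by
    refine (abs_real_inner_le_norm _ _).trans ?_
    have hu0 : 0 ≤ ‖ū‖ := norm_nonneg _
    calc ‖ū‖ * ‖m‖ ≤ ‖ū‖ * (Θ / (8 * (‖ū‖ + 1))) := mul_le_mul_of_nonneg_left hm2 hu0
      _ ≤ Θ / 8 := by
          rw [mul_div_assoc', div_le_div_iff₀ (by positivity) (by norm_num : (0 : ℝ) < 8)]
          nlinarith
  have hi := (abs_le.1 hinner).2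
  nlinarith

end Summit.AtomisticToContinuum.HydrodynamicLimit.Theorems.LocalSecondLawEquilibrium

end
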